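import Summits.CriticalPhenomena.CardyFormulaZ2.Theses.CardySelfRefinement
import Summits.CriticalPhenomena.CardyFormulaZ2.Theorems.CardySelfRefinementLagsToInvariance
import Summits.CriticalPhenomena.CardyFormulaZ2.Theorems.CardySelfRefinementScaleInvariantLimitsStubLagsOfNearIdentityGain
import Summits.CriticalPhenomena.CardyFormulaZ2.Theorems.CardySelfRefinementScaleInvariantLimitsStubScaleInvariantLimitsOfLags
import Summits.CriticalPhenomena.CardyFormulaZ2.Theorems.CardySelfRefinementLagHandOffQuadCompactness
import Literature.Probability.Percolation.QuadCrossingNullFrontier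
import Literature.Probability.Percolation.QuadCrossingSpaceZ2
import Literature.Probability.Percolation.QuadCrossingContinuityEvents
import HarnessLib

/-!
# Line `Sketch` (card `marginal-three-arm-bootstrap`) for the crux `ScaleInvariantLimits`
# (stmt-CriticalPhenomena-10265, route `CardySelfRefinement`) — the lead's skeleton

The planners' sketch (`Cruxes/ScaleInvariantLimits/SketchIdeator3.lean`, card A) proposes the
**near-identity bootstrap**: an `o(τ)` gain of the joint crossing probabilities under the dilation
`S_{1+τ}` (C⁺ = `NearIdentityGain` / `LatticeNearIdentityGain`) composes, inside the `S_t`-stable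
set `Λ` of subsequential limits, to invariance under every lag.  This skeleton RESHAPES the sketch
(lead's remit, L1/L4) in three ways, each forced by the tree or by triage:

* quantifier order `∀ F, ∀ ε, ∃ τ₀, ∀ τ < τ₀` (triage r1-1: uniformity over all finite quad
  families `F` is false already for the `O(τ)` bound; the bootstrap never needs it — it runs at ONE
  fixed family; the card's "Λ = 0" is the `limsup_{τ → 0}` form, i.e. for ALL small `τ`);
* the bootstrap is run ON THE LATTICE ORBIT (`S_t μ_δ = μ_{tδ}`, `dilateLaw_squareCrossingLaw`),
  with the lags `τ_n = k^{1/n} - 1` composing EXACTLY to `k` — so neither the sketch's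
  `DilationContinuityAtOne` nor any continuity-set fact for a general quad (SS11 Lemma 5.1, an
  undischarged named fact in the tree) is needed: stub B is finite telescoping + `n τ_n ≤ k - 1`;
* the passage lattice → limits is the LANDED `Theorems.dilateLaw_eq_self_of_lags`
  (`CardySelfRefinementLagsToInvariance.lean`: soft Lemma 5.1 for one measure, Thm 1.4 (2)
  π-system, Cor 5.2 portmanteau), so the sketch's `CrossingMarginalsDetermine` is not a stub either.

Stubs (registered; composition `ScaleInvariantLimits_of` below):
* `stub_latticeNearIdentityGain` — C⁺ on the lattice orbit (CRUX-SIZED: the open input; lead).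
* `stub_lags_of_nearIdentityGain` — the bootstrap: C⁺ ⇒ the laws at meshes `kη` and `η` merge on
  every joint crossing event, for every `k > 1` — LANDED p86227
  (`Theorems.stub_lags_of_nearIdentityGain`, with the real-variable core
  `Theorems.tendsto_sub_of_nearIdentityGain`).
* `stub_scaleInvariantLimits_of_lags` — merging for all `k > 1` ⇒ the crux, from
  `dilateLaw_eq_self_of_lags` + `S_1 = id`, `S_s S_t = S_{st}` — LANDED p86060
  (`Theorems.stub_scaleInvariantLimits_of_lags`).
* `stub_scaleInvariantLimits_of_nearIdentityGain` (E) — B ∘ C as one conditional theorem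
  (C⁺ ⇒ crux, unfolded); the composition `ScaleInvariantLimits_of` is E applied to A.
  — LANDED p87943 (`Theorems.stub_scaleInvariantLimits_of_nearIdentityGain`).
* certificates, not used by the composition: `stub_nearIdentityGain_of_lags` (D: lag merging ⇒
  C⁺, so C⁺ ⇔ lag merging on the lattice) — LANDED p87789 — and
  `stub_lags_of_scaleInvariantLimits` (F: crux ⇒ lag merging modulo the named fact
  `SchrammSmirnov2011_lemma_5_1`) — LANDED p88074.  Together: stub A ⇔ crux (modulo Lemma 5.1 in
  one direction), i.e. stub A is crux-sized by theorem, not by opinion.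
So the skeleton is CLOSED MODULO STUB A (the only `sorry` in this file).  B, C are one-line
references to the landed theorems; D, E, F repeat their (landed) proofs inline so that this
workfile elaborates without the newest modules.
-/

noncomputable section

open MeasureTheory Filter Set Topology
open Literature.Probability.Percolation Literature.Probability.Percolation.QuadCrossing
open Summit.CriticalPhenomena.CardyFormulaZ2.Theses.CardySelfRefinement

namespace Summit.CriticalPhenomena.CardyFormulaZ2.Cruxes.ScaleInvariantLimits.Lines.Sketch

/-- **STUB A (crux-sized) — C⁺, the near-identity gain on the lattice orbit.**  For every finite
family of quads `G` and every `ε > 0` there is `τ₀ > 0` such that for every lag `1 + τ`,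
`0 < τ < τ₀`, the joint crossing probability of `G` under critical bond-`ℤ²` percolation changes
by at most `ε τ` between meshes `δ` and `(1+τ)δ`, for all small meshes `δ` (smallness depending on
`τ`).  Card: the boundary three-arm count gives `C τ`; the content is the little-`o`
("zero dilation drift rate"). -/
theorem stub_latticeNearIdentityGain (m : ℕ) (G : Fin m → Quad (univ : Set ℂ)) (ε : ℝ)
    (hε : 0 < ε) :
    ∃ τ₀ : ℝ, 0 < τ₀ ∧ ∀ τ ∈ Ioo (0 : ℝ) τ₀, ∃ δ₀ : ℝ, 0 < δ₀ ∧ ∀ δ ∈ Ioo (0 : ℝ) δ₀,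
      |(squareCrossingLaw (univ : Set ℂ) ((1 + τ) * δ) : Measure (QuadConfig (univ : Set ℂ))).real
          {S | ∀ i, G i ∈ S} -
        (squareCrossingLaw (univ : Set ℂ) δ : Measure (QuadConfig (univ : Set ℂ))).real
          {S | ∀ i, G i ∈ S}| ≤ ε * τ := by
  sorry

/-- **STUB B — the near-identity bootstrap on the lattice orbit.**  If C⁺ holds (hypothesis
`hgain`, the statement of stub A for all families), then for every lag `k > 1` and every finite
family `G` the joint crossing probabilities at meshes `kη` and `η` differ by `o(1)` as `η → 0⁺`.
Proof: given `ε`, take `τ₀` from `hgain`, `n` with `τ := k^{1/n} - 1 < τ₀`, `δ₀` from `hgain`;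
for `η < δ₀ / k` telescope along the meshes `(1+τ)^j η`, `j < n` (all `< δ₀`):
`|P_{kη} - P_η| ≤ n ε τ ≤ ε (k - 1)` since `(1 + (k-1)/n)^n ≥ k`. -/
theorem stub_lags_of_nearIdentityGain
    (hgain : ∀ (m : ℕ) (G : Fin m → Quad (univ : Set ℂ)) (ε : ℝ), 0 < ε →
      ∃ τ₀ : ℝ, 0 < τ₀ ∧ ∀ τ ∈ Ioo (0 : ℝ) τ₀, ∃ δ₀ : ℝ, 0 < δ₀ ∧ ∀ δ ∈ Ioo (0 : ℝ) δ₀,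
        |(squareCrossingLaw (univ : Set ℂ) ((1 + τ) * δ) :
              Measure (QuadConfig (univ : Set ℂ))).real {S | ∀ i, G i ∈ S} -
          (squareCrossingLaw (univ : Set ℂ) δ : Measure (QuadConfig (univ : Set ℂ))).real
            {S | ∀ i, G i ∈ S}| ≤ ε * τ)
    (k : ℝ) (hk : 1 < k) (m : ℕ) (G : Fin m → Quad (univ : Set ℂ)) :
    Tendsto (fun η : ℝ =>
      (squareCrossingLaw (univ : Set ℂ) (k * η) : Measure (QuadConfig (univ : Set ℂ))).real
          {S | ∀ i, G i ∈ S} -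
        (squareCrossingLaw (univ : Set ℂ) η : Measure (QuadConfig (univ : Set ℂ))).real
          {S | ∀ i, G i ∈ S}) (𝓝[>] 0) (𝓝 0) :=
  -- LANDED (p86227): Theorems/CardySelfRefinementScaleInvariantLimitsStubLagsOfNearIdentityGain.lean
  Summit.CriticalPhenomena.CardyFormulaZ2.Theorems.stub_lags_of_nearIdentityGain hgain k hk m G

/-- **STUB C — lag merging for every `k > 1` gives the crux.**  If for every `k > 1` and every
finite family of quads the joint crossing probabilities at meshes `kη` and `η` merge as `η → 0⁺`,
then every subsequential limit `μ` is `S_t`-invariant for every `t > 0` (the crux, UNFOLDED — only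
`ScaleInvariantLimits_of` below concludes the route decl by name): `t > 1` is the landed
`Theorems.dilateLaw_eq_self_of_lags`; `t = 1` is `S_1 = id`; `t < 1` follows from `t⁻¹ > 1` and
`S_t S_{t⁻¹} = S_1`. -/
theorem stub_scaleInvariantLimits_of_lags
    (hlags : ∀ k : ℝ, 1 < k → ∀ (m : ℕ) (G : Fin m → Quad (univ : Set ℂ)),
      Tendsto (fun η : ℝ =>
        (squareCrossingLaw (univ : Set ℂ) (k * η) : Measure (QuadConfig (univ : Set ℂ))).real
            {S | ∀ i, G i ∈ S} -
          (squareCrossingLaw (univ : Set ℂ) η : Measure (QuadConfig (univ : Set ℂ))).real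
            {S | ∀ i, G i ∈ S}) (𝓝[>] 0) (𝓝 0))
    (μ : FiniteMeasure (QuadConfig (univ : Set ℂ))) (hμ : μ ∈ subseqQuadLimits (univ : Set ℂ))
    (t : ℝ) (ht : 0 < t) :
    dilateLaw t ht.ne' μ = μ :=
  -- LANDED (p86060): Theorems/CardySelfRefinementScaleInvariantLimitsStubScaleInvariantLimitsOfLags.lean
  Summit.CriticalPhenomena.CardyFormulaZ2.Theorems.stub_scaleInvariantLimits_of_lags hlags μ hμ t ht

/-- **STUB E — C⁺ ⇒ the crux (unfolded)**: the composition of stubs B and C as ONE conditional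
theorem, so that the reduction achieved by the line is importable by name. -/
theorem stub_scaleInvariantLimits_of_nearIdentityGain
    (hgain : ∀ (m : ℕ) (G : Fin m → Quad (univ : Set ℂ)) (ε : ℝ), 0 < ε →
      ∃ τ₀ : ℝ, 0 < τ₀ ∧ ∀ τ ∈ Ioo (0 : ℝ) τ₀, ∃ δ₀ : ℝ, 0 < δ₀ ∧ ∀ δ ∈ Ioo (0 : ℝ) δ₀,
        |(squareCrossingLaw (univ : Set ℂ) ((1 + τ) * δ) :
              Measure (QuadConfig (univ : Set ℂ))).real {S | ∀ i, G i ∈ S} -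
          (squareCrossingLaw (univ : Set ℂ) δ : Measure (QuadConfig (univ : Set ℂ))).real
            {S | ∀ i, G i ∈ S}| ≤ ε * τ)
    (μ : FiniteMeasure (QuadConfig (univ : Set ℂ))) (hμ : μ ∈ subseqQuadLimits (univ : Set ℂ))
    (t : ℝ) (ht : 0 < t) :
    dilateLaw t ht.ne' μ = μ :=
  -- LANDED (p87943) as `Summit.CriticalPhenomena.CardyFormulaZ2.Theorems.stub_scaleInvariantLimits_of_nearIdentityGain`
  -- (Theorems/CardySelfRefinementScaleInvariantLimitsStubScaleInvariantLimitsOfNearIdentityGain.lean);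
  -- here literally the composition of stubs C and B:
  stub_scaleInvariantLimits_of_lags
    (fun k hk m' G' => stub_lags_of_nearIdentityGain hgain k hk m' G') μ hμ t ht

/-! ### Certificates that stub A is crux-sized (not used by the composition) -/

/-- **STUB D — lag merging ⇒ C⁺ (converse of stub B).**  Merging at the single lag `k = 1 + τ`
read below the positive level `ε τ`.  With stub B: on the lattice, C⁺ ⇔ lag merging for every
`k > 1` (the crossing-event form of the disprover's `AsymptoticLagInvariance`, Disproof §4). -/
theorem stub_nearIdentityGain_of_lags
    (hlags : ∀ k : ℝ, 1 < k → ∀ (m : ℕ) (G : Fin m → Quad (univ : Set ℂ)),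
      Tendsto (fun η : ℝ =>
        (squareCrossingLaw (univ : Set ℂ) (k * η) : Measure (QuadConfig (univ : Set ℂ))).real
            {S | ∀ i, G i ∈ S} -
          (squareCrossingLaw (univ : Set ℂ) η : Measure (QuadConfig (univ : Set ℂ))).real
            {S | ∀ i, G i ∈ S}) (𝓝[>] 0) (𝓝 0))
    (m : ℕ) (G : Fin m → Quad (univ : Set ℂ)) (ε : ℝ) (hε : 0 < ε) :
    ∃ τ₀ : ℝ, 0 < τ₀ ∧ ∀ τ ∈ Ioo (0 : ℝ) τ₀, ∃ δ₀ : ℝ, 0 < δ₀ ∧ ∀ δ ∈ Ioo (0 : ℝ) δ₀,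
      |(squareCrossingLaw (univ : Set ℂ) ((1 + τ) * δ) : Measure (QuadConfig (univ : Set ℂ))).real
          {S | ∀ i, G i ∈ S} -
        (squareCrossingLaw (univ : Set ℂ) δ : Measure (QuadConfig (univ : Set ℂ))).real
          {S | ∀ i, G i ∈ S}| ≤ ε * τ := by
  -- LANDED (p87789) as `Summit.CriticalPhenomena.CardyFormulaZ2.Theorems.stub_nearIdentityGain_of_lags`
  -- (Theorems/CardySelfRefinementScaleInvariantLimitsStubNearIdentityGainOfLags.lean); proof repeated inline:
  refine ⟨1, one_pos, fun τ hτ => ?_⟩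
  have h := hlags (1 + τ) (by linarith [hτ.1]) m G
  rw [Metric.tendsto_nhdsWithin_nhds] at h
  obtain ⟨δ₀, hδ₀, hδ⟩ := h (ε * τ) (mul_pos hε hτ.1)
  refine ⟨δ₀, hδ₀, fun δ hδ' => ?_⟩
  have hdist : dist δ 0 < δ₀ := by
    rw [Real.dist_eq, sub_zero, abs_of_pos hδ'.1]
    exact hδ'.2
  have := hδ hδ'.1 hdist
  rw [Real.dist_eq, sub_zero] at this
  exact this.le

/-- **STUB F — the crux ⇒ lag merging, modulo Schramm–Smirnov's Lemma 5.1** (the tree's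
undischarged named fact `SchrammSmirnov2011_lemma_5_1`: every crossing event is a continuity set
of every subsequential limit).  Contrapositive by compactness (SS11 Cor. 1.6): a bad mesh sequence
has a subsequence converging in law to some `μ ∈ Λ`, its `k`-dilates converge to `S_k μ = μ`, and
Cor. 5.2 makes both joint crossing probabilities converge to `μ {∀ i, G i ∈ S}`.  With stubs
B–E: stub A ⇔ lag merging ⇔ `X`, the last arrow modulo Lemma 5.1 — stub A IS the crux, relocated. -/
theorem stub_lags_of_scaleInvariantLimits (h51 : SchrammSmirnov2011_lemma_5_1)
    (hX : ScaleInvariantLimits) (k : ℝ) (hk : 1 < k) (m : ℕ) (G : Fin m → Quad (univ : Set ℂ)) :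
    Tendsto (fun η : ℝ =>
      (squareCrossingLaw (univ : Set ℂ) (k * η) : Measure (QuadConfig (univ : Set ℂ))).real
          {S | ∀ i, G i ∈ S} -
        (squareCrossingLaw (univ : Set ℂ) η : Measure (QuadConfig (univ : Set ℂ))).real
          {S | ∀ i, G i ∈ S}) (𝓝[>] 0) (𝓝 0) := by
  -- LANDED (p88074) as `Summit.CriticalPhenomena.CardyFormulaZ2.Theorems.stub_lags_of_scaleInvariantLimits`
  -- (Theorems/CardySelfRefinementScaleInvariantLimitsStubLagsOfScaleInvariantLimits.lean); proof repeated inline: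
  have hk0 : 0 < k := by linarith
  -- Cor. 5.2 at a subsequential limit, given Lemma 5.1
  have hcor : ∀ {ν : FiniteMeasure (QuadConfig (univ : Set ℂ))}, ν ∈ subseqQuadLimits (univ : Set ℂ) →
      ∀ {δs : ℕ → ℝ}, Tendsto (fun n => squareCrossingLaw (univ : Set ℂ) (δs n)) atTop (𝓝 ν) →
        Tendsto (fun n => (squareCrossingLaw (univ : Set ℂ) (δs n) :
            Measure (QuadConfig (univ : Set ℂ))).real {S | ∀ i, G i ∈ S}) atTop
          (𝓝 ((ν : Measure (QuadConfig (univ : Set ℂ))).real {S | ∀ i, G i ∈ S})) := by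
    intro ν hν δs hconv
    have h := tendsto_measure_of_null_frontier_generateFrom isOpen_univ univ_nonempty hconv
      (finite_range G) (fun Q _ => h51 univ isOpen_univ univ_nonempty ν hν Q)
      (Summit.CriticalPhenomena.CardyFormulaZ2.Theorems.measurableSet_generateFrom_setOf_forall_mem G)
    have h' := (ENNReal.tendsto_toReal (measure_ne_top _ _)).comp h
    simp only [measureReal_def]
    exact h'
  set d : ℝ → ℝ := fun η =>
    (squareCrossingLaw (univ : Set ℂ) (k * η) : Measure (QuadConfig (univ : Set ℂ))).real
        {S | ∀ i, G i ∈ S} -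
      (squareCrossingLaw (univ : Set ℂ) η : Measure (QuadConfig (univ : Set ℂ))).real
        {S | ∀ i, G i ∈ S} with hd
  rw [Metric.tendsto_nhdsWithin_nhds]
  by_contra hcon
  push Not at hcon
  obtain ⟨ε, hε, hbad⟩ := hcon
  -- a bad positive mesh sequence `ηₙ → 0`
  choose η hηpos hηdist hηbad using fun n : ℕ => hbad (1 / ((n : ℝ) + 1)) (by positivity)
  have hη0 : Tendsto η atTop (𝓝 0) := by
    rw [tendsto_iff_dist_tendsto_zero]
    exact squeeze_zero (fun n => dist_nonneg) (fun n => (hηdist n).le)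
      tendsto_one_div_add_atTop_nhds_zero_nat
  -- compactness: a subsequence converges in law to a subsequential limit `μ`
  have h2 : 0 < Real.sqrt 2 := Real.sqrt_pos.mpr two_pos
  obtain ⟨φ, -, μ, hμ, hconvz⟩ :=
    Cruxes.LagHandOff.CrosscutDictionary.exists_mem_subseqQuadLimits_tendsto_subseq
      (fun n => η n * Real.sqrt 2) (fun n => mul_pos (hηpos n) h2)
      (by simpa using hη0.mul_const (Real.sqrt 2))
  have hconv : Tendsto (fun n => squareCrossingLaw (univ : Set ℂ) (η (φ n))) atTop (𝓝 μ) := by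
    simpa only [squareCrossingLaw_eq_z2QuadLaw] using hconvz
  -- the `k`-dilated laws converge to `S_k μ = μ`
  have hconvk : Tendsto (fun n => squareCrossingLaw (univ : Set ℂ) (k * η (φ n))) atTop (𝓝 μ) := by
    have h := FiniteMeasure.tendsto_map_of_tendsto_of_continuous _ _ hconv
      (QuadConfig.continuous_mapHomeomorph
        (Homeomorph.mulLeft₀ (k : ℂ) (Complex.ofReal_ne_zero.mpr hk0.ne')))
    have hfun : (fun n => (squareCrossingLaw (univ : Set ℂ) (η (φ n))).map
        (QuadConfig.mapHomeomorph
          (Homeomorph.mulLeft₀ (k : ℂ) (Complex.ofReal_ne_zero.mpr hk0.ne')))) =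
        fun n => squareCrossingLaw (univ : Set ℂ) (k * η (φ n)) :=
      funext fun n =>
        Summit.CriticalPhenomena.CardyFormulaZ2.Theorems.dilateLaw_squareCrossingLaw hk0.ne' (η (φ n))
    rw [hfun] at h
    have h' : Tendsto (fun n => squareCrossingLaw (univ : Set ℂ) (k * η (φ n))) atTop
        (𝓝 (dilateLaw k hk0.ne' μ)) := h
    rwa [hX μ hμ k hk0] at h'
  -- both joint crossing probabilities converge to `μ {∀ i, G i ∈ S}`
  have h1 := hcor hμ hconv
  have h2' := hcor hμ hconvk
  have h3 : Tendsto (fun n => d (η (φ n))) atTop (𝓝 0) := by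
    have := h2'.sub h1
    rw [sub_self] at this
    simpa only [hd] using this
  -- contradiction with `ε ≤ |d (η (φ n))|`
  obtain ⟨n, hn⟩ := ((Metric.tendsto_nhds.mp h3) ε hε).exists
  exact (not_le.mpr hn) (hηbad (φ n))

/-! ### The composition -/

/-- **Composition of the line**: stub A fed into stub E (= stubs B, C) gives the crux
`ScaleInvariantLimits` BY NAME.  Closed modulo stub A only. -/
theorem ScaleInvariantLimits_of : ScaleInvariantLimits :=
  fun μ hμ t ht =>
    stub_scaleInvariantLimits_of_nearIdentityGain stub_latticeNearIdentityGain μ hμ t ht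

end Summit.CriticalPhenomena.CardyFormulaZ2.Cruxes.ScaleInvariantLimits.Lines.Sketch

end
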